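import Literature.GroupTheory.CombinatorialGroupTheory.PuncturedSurfaceGroupTwoNodeCycleBases
import HarnessLib

/-!
# The free basis of `Γ_{g,r+1}` eliminating an ARBITRARY puncture generator `c_t`

`Γ_{g,r+1} = ⟨a_i, b_i, c_0, …, c_r ∣ [a_0,b_0]⋯[a_{g-1},b_{g-1}]·c_0⋯c_r⟩` (`PuncturedSurfaceGroup g (r+1)`,
[SemiAnbd] Example 2.10 [cite: MochizukiSemiAnbd2006, Ex. 2.10 p.31]).  Companion of
`PuncturedSurfaceGroupCuspBases.lean` (elimination of `c_0`, of `c_1`) and `PuncturedSurfaceGroupCuspBasesLast.lean`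
(`c_r`): here ANY `c_t` is eliminated,
`c_t = (c_0⋯c_{t-1})⁻¹ ([a_0,b_0]⋯[a_{g-1},b_{g-1}])⁻¹ (c_{t+1}⋯c_r)⁻¹`, so that all the other `c_j`
(`j = t.succAbove z`) are letters — the bases needed when the cusps of ONE component other than a chosen
one must be letters together with a far cusp (abc-iut-f-164, [CombGC] Prop. 1.5 (i) at the two-node-cycle
shape, successor row «TWO-NODE-CYCLE·PROP15»).

* `c_eq_of_split` — the relator solved for `c_t`;
* `exists_mulEquiv_freeGroup_elim` — `Γ_{g,r+1} ≃* F((Fin g × Bool) ⊕ Fin r)`, `a_i, b_i ↦` their letters,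
  `c_{t.succAbove z} ↦ inr z`;
* `exists_freeGroupBasis_elim` — the same packaged as a `FreeGroupBasis` with its values.
Theorems only; elementary combinatorial group theory.
-/

namespace Literature.GroupTheory.CombinatorialGroupTheory.PuncturedSurfaceGroup

variable {g r : ℕ}

/-- The surface relation solved for the puncture generator `c_t`:
`c_t = (c_0⋯c_{t-1})⁻¹ ([a_0,b_0]⋯[a_{g-1},b_{g-1}])⁻¹ (c_{t+1}⋯c_r)⁻¹`. [cite: MochizukiSemiAnbd2006, Ex. 2.10 p.31] -/
theorem c_eq_of_split (t : Fin (r + 1)) :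
    c (g := g) t =
      (((List.finRange (r + 1)).map fun j : Fin (r + 1) => if (j : ℕ) < t then c (g := g) j else 1).prod)⁻¹ *
      (((List.finRange g).map fun i : Fin g =>
          a (r := r + 1) i * b i * (a i)⁻¹ * (b i)⁻¹).prod)⁻¹ *
      (((List.finRange (r + 1)).map fun j : Fin (r + 1) => if (t : ℕ) + 1 ≤ (j : ℕ) then c (g := g) j else 1).prod)⁻¹ := by
  classical
  have h := comm_prod_mul_cusp_prod_eq_one (g := g) (r := r + 1)
  rw [prod_map_finRange_split (r + 1) t (fun j => c (g := g) j), prod_map_finRange_ite_le_peel (r + 1) t t.2,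
    Fin.eta] at h
  -- `h : X * (C₁ * (c_t * C₂)) = 1`
  set X := ((List.finRange g).map fun i : Fin g => a (r := r + 1) i * b i * (a i)⁻¹ * (b i)⁻¹).prod
  set C₁ := ((List.finRange (r + 1)).map fun j : Fin (r + 1) => if (j : ℕ) < t then c (g := g) j else 1).prod
  set C₂ := ((List.finRange (r + 1)).map fun j : Fin (r + 1) =>
    if (t : ℕ) + 1 ≤ (j : ℕ) then c (g := g) j else 1).prod
  have h1 : X * C₁ * (c t * C₂) = 1 := by simpa only [mul_assoc] using h
  have h2 : c t * C₂ = (X * C₁)⁻¹ := eq_inv_of_mul_eq_one_right h1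
  rw [eq_mul_inv_of_mul_eq h2, mul_inv_rev]

variable (g r)

/-- **`Γ_{g,r+1}` is free on `a_i, b_i` and the `c_j`, `j ≠ t`** (Tietze elimination of the puncture
generator `c_t`), with the images recorded: `a_i ↦ inl (i,false)`, `b_i ↦ inl (i,true)`,
`c_{t.succAbove z} ↦ inr z`. [cite: MochizukiSemiAnbd2006, Ex. 2.10 p.31] -/
theorem exists_mulEquiv_freeGroup_elim (t : Fin (r + 1)) :
    ∃ e : PuncturedSurfaceGroup g (r + 1) ≃* FreeGroup ((Fin g × Bool) ⊕ Fin r),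
      (∀ i, e (a i) = FreeGroup.of (Sum.inl (i, false))) ∧
      (∀ i, e (b i) = FreeGroup.of (Sum.inl (i, true))) ∧
      ∀ z : Fin r, e (c (t.succAbove z)) = FreeGroup.of (Sum.inr z) := by
  classical
  let comm : FreeGroup (puncturedSurfaceGen g (r + 1)) :=
    ((List.finRange g).map fun i =>
      genA (r := r + 1) i * genB (r := r + 1) i * (genA (r := r + 1) i)⁻¹ *
        (genB (r := r + 1) i)⁻¹).prod
  let cs : FreeGroup (puncturedSurfaceGen g (r + 1)) :=
    ((List.finRange (r + 1)).map fun j => genC (g := g) j).prod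
  have hrel_eq : relator g (r + 1) = comm * cs := rfl
  let A : FreeGroup ((Fin g × Bool) ⊕ Fin r) := ((List.finRange g).map fun i =>
      FreeGroup.of (Sum.inl (i, false)) * FreeGroup.of (Sum.inl (i, true)) *
        (FreeGroup.of (Sum.inl (i, false)))⁻¹ * (FreeGroup.of (Sum.inl (i, true)))⁻¹).prod
  -- the letters of the other cusps, `1` at `t`
  let F' : Fin (r + 1) → FreeGroup ((Fin g × Bool) ⊕ Fin r) :=
    Fin.insertNth (α := fun _ => FreeGroup ((Fin g × Bool) ⊕ Fin r)) t 1 fun z => FreeGroup.of (Sum.inr z)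
  have hF's : ∀ z : Fin r, F' (t.succAbove z) = FreeGroup.of (Sum.inr z) := fun z => by
    simp only [F', Fin.insertNth_apply_succAbove]
  let P₁ : FreeGroup ((Fin g × Bool) ⊕ Fin r) :=
    ((List.finRange (r + 1)).map fun j : Fin (r + 1) => if (j : ℕ) < t then F' j else 1).prod
  let P₂ : FreeGroup ((Fin g × Bool) ⊕ Fin r) :=
    ((List.finRange (r + 1)).map fun j : Fin (r + 1) => if (t : ℕ) + 1 ≤ (j : ℕ) then F' j else 1).prod
  let W : FreeGroup ((Fin g × Bool) ⊕ Fin r) := P₁⁻¹ * A⁻¹ * P₂⁻¹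
  let f : puncturedSurfaceGen g (r + 1) → FreeGroup ((Fin g × Bool) ⊕ Fin r) := fun x =>
    match x with
    | Sum.inl y => FreeGroup.of (Sum.inl y)
    | Sum.inr j => Fin.insertNth (α := fun _ => FreeGroup ((Fin g × Bool) ⊕ Fin r)) t W
        (fun z => FreeGroup.of (Sum.inr z)) j
  have hft : f (Sum.inr t) = W := by simp [f]
  have hfs : ∀ z : Fin r, f (Sum.inr (t.succAbove z)) = FreeGroup.of (Sum.inr z) := fun z => by
    simp only [f, Fin.insertNth_apply_succAbove]
  have hfF : ∀ j : Fin (r + 1), j ≠ t → f (Sum.inr j) = F' j := fun j hj => by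
    obtain ⟨z, rfl⟩ := Fin.exists_succAbove_eq hj
    rw [hfs, hF's]
  have hfA : FreeGroup.lift f comm = A := by
    simp only [comm, A, map_list_prod, List.map_map, Function.comp_def, map_mul, map_inv, genA, genB,
      FreeGroup.lift_apply_of, f]
  have hfcs : FreeGroup.lift f cs = P₁ * (W * P₂) := by
    have h0 : FreeGroup.lift f cs = ((List.finRange (r + 1)).map fun j => f (Sum.inr j)).prod := by
      simp only [cs, map_list_prod, List.map_map, Function.comp_def, genC, FreeGroup.lift_apply_of]
    rw [h0, prod_map_finRange_split (r + 1) t, prod_map_finRange_ite_le_peel (r + 1) t t.2, Fin.eta, hft]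
    congr 1
    · refine congrArg List.prod (List.map_congr_left fun j _ => ?_)
      by_cases hj : (j : ℕ) < t
      · rw [if_pos hj, if_pos hj, hfF j (fun h => by subst h; omega)]
      · rw [if_neg hj, if_neg hj]
    · congr 1
      refine congrArg List.prod (List.map_congr_left fun j _ => ?_)
      by_cases hj : (t : ℕ) + 1 ≤ (j : ℕ)
      · rw [if_pos hj, if_pos hj, hfF j (fun h => by subst h; omega)]
      · rw [if_neg hj, if_neg hj]
  have hrel : ∀ w ∈ ({relator g (r + 1)} : Set (FreeGroup (puncturedSurfaceGen g (r + 1)))),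
      FreeGroup.lift f w = 1 := by
    intro w hw
    rw [Set.mem_singleton_iff] at hw
    rw [hw, hrel_eq, map_mul, hfA, hfcs]
    simp only [W]
    group
  let φ : PuncturedSurfaceGroup g (r + 1) →* FreeGroup ((Fin g × Bool) ⊕ Fin r) :=
    PresentedGroup.toGroup hrel
  let ψ : FreeGroup ((Fin g × Bool) ⊕ Fin r) →* PuncturedSurfaceGroup g (r + 1) :=
    FreeGroup.lift fun y =>
      match y with
      | Sum.inl x => PresentedGroup.of (Sum.inl x)
      | Sum.inr z => PresentedGroup.of (Sum.inr (t.succAbove z))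
  have hψA : ψ A = ((List.finRange g).map fun i : Fin g => a (r := r + 1) i * b i * (a i)⁻¹ * (b i)⁻¹).prod := by
    simp only [A, map_list_prod, List.map_map, Function.comp_def, map_mul, map_inv, ψ,
      FreeGroup.lift_apply_of]
    rfl
  have hψF' : ∀ j : Fin (r + 1), j ≠ t → ψ (F' j) = c j := fun j hj => by
    obtain ⟨z, rfl⟩ := Fin.exists_succAbove_eq hj
    rw [hF's]
    simp only [ψ, FreeGroup.lift_apply_of]
    rfl
  have hψP₁ : ψ P₁ = ((List.finRange (r + 1)).map fun j : Fin (r + 1) =>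
      if (j : ℕ) < t then c (g := g) j else 1).prod := by
    simp only [P₁, map_list_prod, List.map_map]
    refine congrArg List.prod (List.map_congr_left fun j _ => ?_)
    simp only [Function.comp_apply]
    by_cases hj : (j : ℕ) < t
    · rw [if_pos hj, if_pos hj, hψF' j (fun h => by subst h; omega)]
    · rw [if_neg hj, if_neg hj, map_one]
  have hψP₂ : ψ P₂ = ((List.finRange (r + 1)).map fun j : Fin (r + 1) =>
      if (t : ℕ) + 1 ≤ (j : ℕ) then c (g := g) j else 1).prod := by
    simp only [P₂, map_list_prod, List.map_map]
    refine congrArg List.prod (List.map_congr_left fun j _ => ?_)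
    simp only [Function.comp_apply]
    by_cases hj : (t : ℕ) + 1 ≤ (j : ℕ)
    · rw [if_pos hj, if_pos hj, hψF' j (fun h => by subst h; omega)]
    · rw [if_neg hj, if_neg hj, map_one]
  have hψW : ψ W = c t := by
    simp only [W, map_mul, map_inv]
    rw [hψP₁, hψA, hψP₂, c_eq_of_split t]
  have h₁ : ψ.comp φ = MonoidHom.id _ := by
    apply PresentedGroup.ext
    intro x
    rw [MonoidHom.comp_apply, MonoidHom.id_apply]
    change ψ (PresentedGroup.toGroup hrel (PresentedGroup.of x)) = _
    rw [PresentedGroup.toGroup.of]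
    rcases x with y | j
    · simp [f, ψ]
    · by_cases hj : j = t
      · subst hj
        rw [hft, hψW]
        rfl
      · obtain ⟨z, rfl⟩ := Fin.exists_succAbove_eq hj
        rw [hfs]
        simp [ψ]
  have h₂ : φ.comp ψ = MonoidHom.id _ := by
    apply FreeGroup.ext_hom
    intro y
    rw [MonoidHom.comp_apply, MonoidHom.id_apply]
    rcases y with x | z
    · simp only [ψ, FreeGroup.lift_apply_of]
      change PresentedGroup.toGroup hrel (PresentedGroup.of (Sum.inl x)) = _
      rw [PresentedGroup.toGroup.of]
    · simp only [ψ, FreeGroup.lift_apply_of]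
      change PresentedGroup.toGroup hrel (PresentedGroup.of (Sum.inr (t.succAbove z))) = _
      rw [PresentedGroup.toGroup.of, hfs]
  refine ⟨MonoidHom.toMulEquiv φ ψ h₁ h₂, fun i => ?_, fun i => ?_, fun z => ?_⟩
  · change PresentedGroup.toGroup hrel (PresentedGroup.of (Sum.inl (i, false))) = _
    rw [PresentedGroup.toGroup.of]
  · change PresentedGroup.toGroup hrel (PresentedGroup.of (Sum.inl (i, true))) = _
    rw [PresentedGroup.toGroup.of]
  · change PresentedGroup.toGroup hrel (PresentedGroup.of (Sum.inr (t.succAbove z))) = _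
    rw [PresentedGroup.toGroup.of, hfs]

variable {g r}

/-- **The `c_t`-eliminating free basis of `Γ_{g,r+1}`**, packaged: `b(i,false) = a_i`, `b(i,true) = b_i`,
`b(inr z) = c_{t.succAbove z}`. [cite: MochizukiSemiAnbd2006, Ex. 2.10 p.31] -/
theorem exists_freeGroupBasis_elim (g r : ℕ) (t : Fin (r + 1)) :
    ∃ bt : FreeGroupBasis ((Fin g × Bool) ⊕ Fin r) (PuncturedSurfaceGroup g (r + 1)),
      (∀ i, bt (Sum.inl (i, false)) = a i) ∧ (∀ i, bt (Sum.inl (i, true)) = b i) ∧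
        ∀ z : Fin r, bt (Sum.inr z) = c (t.succAbove z) := by
  obtain ⟨e, hea, heb, hec⟩ := exists_mulEquiv_freeGroup_elim g r t
  refine ⟨FreeGroupBasis.ofRepr e, fun i => ?_, fun i => ?_, fun z => ?_⟩
  · change e.symm (FreeGroup.of (Sum.inl (i, false))) = a i
    rw [← hea i, MulEquiv.symm_apply_apply]
  · change e.symm (FreeGroup.of (Sum.inl (i, true))) = b i
    rw [← heb i, MulEquiv.symm_apply_apply]
  · change e.symm (FreeGroup.of (Sum.inr z)) = c (t.succAbove z)
    rw [← hec z, MulEquiv.symm_apply_apply]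

end Literature.GroupTheory.CombinatorialGroupTheory.PuncturedSurfaceGroup
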